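import Summits.CriticalPhenomena.SAWScalingLimit.Theorems.SAWBrickWallHomotopyModulusUniversalityAffineTransport
import Summits.CriticalPhenomena.SAWScalingLimit.Theorems.SAWBrickWallHomotopyModulusUniversalityJitteredDrawing
import HarnessLib

/-!
# `ModulusUniversality`, line `birth`: transport of honeycomb boundary avoidance to the jittered law

Helper file (`--supports stmt-CriticalPhenomena-5790`) of the line `birth` / `registered` for the
crux `SAWBrickWallHomotopy.ModulusUniversality` (skeleton
`Summits/CriticalPhenomena/SAWScalingLimit/Cruxes/ModulusUniversality/Lines/birth.lean`, reshape 5,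
lead c2): the registered PROVABLE stub `stub_boundaryAvoidanceTransport` (BA_T), literal signature —
boundary avoidance of the PLAIN critical honeycomb law `hexSAWLaw` (stub BA_hex, for every Dobrushin
domain and hexagonal endpoint approximation) implies boundary avoidance of the JITTERED honeycomb law
of `E` (graph `hexGraph` embedded by `B ∘ hexCenter`, `B = diag(2, 2/√3)`) read on brick-wall sites.

* `exists_support_preserving_map_embLaw` — if two discretisations of one abstract graph have EQUAL
  discrete domain graphs, the identity of vertices induces a support-preserving bijection of
  self-avoiding walks pushing one SAW law `P_{x,δ}` to the other (weights `x^{#vertices}` agree).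
* metric bookkeeping for `B`: `‖z‖ ≤ ‖B z‖ ≤ 2‖z‖`, hence `infDist(p, (B⁻¹E)ᶜ) ≤ infDist(B p, Eᶜ)`
  and `dist(B p, B q) ≤ 2 dist(p, q)`; jitter `dist(δ · site w, δ B c_w) ≤ 2δ/3`
  (`dist_meshPoint_site_le`).
* `stub_boundaryAvoidanceTransport`: apply BA_hex to `B⁻¹E = E.map B.symm` (endpoint approximation
  transported by `stub_affineTransport`) with `(ρ/4, ε)`, collar `η`; the jittered estimate holds
  with collar `η/2` once `δ ≤ 3 min(η, ρ)/4`, by the event inclusion above and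
  `embDomainGraph_affine`.

All bookkeeping tagged [folklore].  No definitions.
-/

noncomputable section

open MeasureTheory Filter Topology Metric Set
open scoped NNReal ENNReal
open Literature.Probability.LatticeModels
open Literature.Probability.RandomPlanarGeometry

namespace Summit.CriticalPhenomena.SAWScalingLimit.Cruxes.ModulusUniversality.Birth

/-! ### Transport of the SAW law along an equality of discrete domain graphs -/

/-- **Support-preserving transport of `P_{x,δ}`.**  If two discretisations `(emb, Ω, δ)` and
`(emb', Ω', δ')` of one abstract graph `G` have the same discrete domain graph, then mapping each
walk along the identity of vertices is a bijection of self-avoiding walks preserving supports (hence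
vertex counts and weights) which pushes `embLaw G emb Ω δ x a b` forward to `embLaw G emb' Ω' δ' x a b`.
[folklore] -/
theorem exists_support_preserving_map_embLaw {V : Type*} {G : SimpleGraph V} {emb emb' : V → ℂ}
    {Ω Ω' : Set ℂ} {δ δ' : ℝ}
    (hG : SAW.embDomainGraph G emb Ω δ = SAW.embDomainGraph G emb' Ω' δ') (x : ℝ) (a b : V) :
    ∃ T : SAW.EmbDomainSAW G emb Ω δ a b → SAW.EmbDomainSAW G emb' Ω' δ' a b,
      (∀ γ, (T γ).walk.support = γ.walk.support) ∧
      (SAW.embLaw G emb Ω δ x a b).map T = SAW.embLaw G emb' Ω' δ' x a b := by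
  classical
  set φ : SAW.embDomainGraph G emb Ω δ →g SAW.embDomainGraph G emb' Ω' δ' :=
    SimpleGraph.Hom.ofLE hG.le with hφ
  set ψ : SAW.embDomainGraph G emb' Ω' δ' →g SAW.embDomainGraph G emb Ω δ :=
    SimpleGraph.Hom.ofLE hG.ge with hψ
  have hφid : ∀ v, φ v = v := fun v => rfl
  have hψid : ∀ v, ψ v = v := fun v => rfl
  have hφinj : Function.Injective φ := fun u v h => by simpa [hφid] using h
  have hψinj : Function.Injective ψ := fun u v h => by simpa [hψid] using h
  set T : SAW.EmbDomainSAW G emb Ω δ a b → SAW.EmbDomainSAW G emb' Ω' δ' a b :=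
    fun γ => ⟨γ.walk.map φ, γ.isPath.map hφinj⟩ with hT
  set T' : SAW.EmbDomainSAW G emb' Ω' δ' a b → SAW.EmbDomainSAW G emb Ω δ a b :=
    fun γ => ⟨γ.walk.map ψ, γ.isPath.map hψinj⟩ with hT'
  have hsupp : ∀ γ, (T γ).walk.support = γ.walk.support := fun γ => by
    change (γ.walk.map φ).support = γ.walk.support
    rw [SimpleGraph.Walk.support_map]
    conv_rhs => rw [← List.map_id γ.walk.support]
    exact List.map_congr_left fun u _ => hφid u
  have hwalk_inj : ∀ {c d : V},
      Function.Injective (SAW.EmbDomainSAW.walk : SAW.EmbDomainSAW G emb' Ω' δ' c d → _) := by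
    rintro c d ⟨p, hp⟩ ⟨q, hq⟩ h
    cases h
    rfl
  have hwalk_inj₁ : ∀ {c d : V},
      Function.Injective (SAW.EmbDomainSAW.walk : SAW.EmbDomainSAW G emb Ω δ c d → _) := by
    rintro c d ⟨p, hp⟩ ⟨q, hq⟩ h
    cases h
    rfl
  have key : ∀ {u v : V} (p : (SAW.embDomainGraph G emb' Ω' δ').Walk u v),
      (p.map ψ).map φ = p := by
    intro u v p
    induction p with
    | nil => rfl
    | cons h p ih =>
      rw [SimpleGraph.Walk.map_cons, SimpleGraph.Walk.map_cons, ih]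
      rfl
  have key₁ : ∀ {u v : V} (p : (SAW.embDomainGraph G emb Ω δ).Walk u v),
      (p.map φ).map ψ = p := by
    intro u v p
    induction p with
    | nil => rfl
    | cons h p ih =>
      rw [SimpleGraph.Walk.map_cons, SimpleGraph.Walk.map_cons, ih]
      rfl
  have hTT' : ∀ γ, T (T' γ) = γ := fun γ => hwalk_inj (key γ.walk)
  have hT'T : ∀ γ, T' (T γ) = γ := fun γ => hwalk_inj₁ (key₁ γ.walk)
  have hTbij : Function.Bijective T :=
    ⟨Function.LeftInverse.injective hT'T, Function.RightInverse.surjective hTT'⟩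
  have hTm : Measurable T := SAW.EmbDomainSAW.measurable_of_top _
  have hlen : ∀ γ, (T γ).vertexCount = γ.vertexCount := fun γ => by
    have h := congrArg List.length (hsupp γ)
    rw [SimpleGraph.Walk.length_support, SimpleGraph.Walk.length_support] at h
    simp only [SAW.EmbDomainSAW.vertexCount, SAW.EmbDomainSAW.length]
    omega
  have hweight : (SAW.embWeight G emb Ω δ x a b).map T = SAW.embWeight G emb' Ω' δ' x a b := by
    rw [SAW.embWeight, Measure.map_sum hTm.aemeasurable]
    simp only [Measure.map_smul, Measure.map_dirac' hTm]
    rw [SAW.embWeight, ← Measure.sum_comp_equiv (Equiv.ofBijective T hTbij)]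
    congr 1
    funext γ
    simp only [Function.comp_apply, Equiv.ofBijective_apply, hlen]
  refine ⟨T, hsupp, ?_⟩
  rw [SAW.embLaw, Measure.map_smul, hweight, SAW.embLaw, ← hweight,
    Measure.map_apply hTm MeasurableSet.univ, Set.preimage_univ]

/-! ### Metric bookkeeping for the affinity `B = diag(2, 2/√3)` -/

section Affinity

variable {B : ℂ ≃ₜ ℂ}
  (hB : ∀ z : ℂ, B z = ((2 * z.re : ℝ) : ℂ) + ((2 / Real.sqrt 3 * z.im : ℝ) : ℂ) * Complex.I)
include hB

/-- `B` is real-homogeneous. [folklore] -/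
private theorem affT_real_mul (r : ℝ) (z : ℂ) : B ((r : ℂ) * z) = (r : ℂ) * B z := by
  simp only [hB]
  apply Complex.ext
  · simp only [Complex.add_re, Complex.mul_re, Complex.mul_im, Complex.ofReal_re,
      Complex.ofReal_im, Complex.I_re, Complex.I_im, Complex.add_im]
    ring
  · simp only [Complex.add_re, Complex.mul_re, Complex.mul_im, Complex.ofReal_re,
      Complex.ofReal_im, Complex.I_re, Complex.I_im, Complex.add_im]
    ring

/-- `B` is affine on segments. [folklore] -/
private theorem affT_lineMap (x y : ℂ) (c : ℝ) :
    B (AffineMap.lineMap x y c) = AffineMap.lineMap (B x) (B y) c := by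
  rw [AffineMap.lineMap_apply_module', AffineMap.lineMap_apply_module', Complex.real_smul,
    Complex.real_smul]
  simp only [hB]
  apply Complex.ext
  · simp only [Complex.add_re, Complex.add_im, Complex.sub_re, Complex.sub_im, Complex.mul_re,
      Complex.mul_im, Complex.ofReal_re, Complex.ofReal_im, Complex.I_re, Complex.I_im]
    ring
  · simp only [Complex.add_re, Complex.add_im, Complex.sub_re, Complex.sub_im, Complex.mul_re,
      Complex.mul_im, Complex.ofReal_re, Complex.ofReal_im, Complex.I_re, Complex.I_im]
    ring

/-- `B` is additive: `B p - B s = B (p - s)`. [folklore] -/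
theorem affinityB_sub (p s : ℂ) : B p - B s = B (p - s) := by
  simp only [hB]
  apply Complex.ext
  · simp only [Complex.add_re, Complex.sub_re, Complex.mul_re, Complex.ofReal_re,
      Complex.ofReal_im, Complex.I_re, Complex.I_im, Complex.sub_im]
    ring
  · simp only [Complex.sub_re, Complex.mul_im, Complex.ofReal_re,
      Complex.ofReal_im, Complex.I_re, Complex.I_im, Complex.add_im, Complex.sub_im]
    ring

/-- `‖B z‖² = 4 re² + (4/3) im²`. [folklore] -/
theorem sq_norm_affinityB (z : ℂ) : ‖B z‖ ^ 2 = 4 * z.re ^ 2 + 4 / 3 * z.im ^ 2 := by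
  have h3 : Real.sqrt 3 ^ 2 = 3 := Real.sq_sqrt (by norm_num)
  have hre : (B z).re = 2 * z.re := by
    rw [hB]; simp
  have him : (B z).im = 2 / Real.sqrt 3 * z.im := by
    rw [hB]; simp
  rw [Complex.sq_norm, Complex.normSq_apply, hre, him]
  have : (2 / Real.sqrt 3) ^ 2 = 4 / 3 := by rw [div_pow, h3]; norm_num
  nlinarith [this]

/-- `‖z‖ ≤ ‖B z‖`. [folklore] -/
theorem norm_le_norm_affinityB (z : ℂ) : ‖z‖ ≤ ‖B z‖ := by
  rw [← sq_le_sq₀ (norm_nonneg _) (norm_nonneg _), sq_norm_affinityB hB, Complex.sq_norm,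
    Complex.normSq_apply]
  nlinarith [sq_nonneg z.re, sq_nonneg z.im]

/-- `‖B z‖ ≤ 2‖z‖`. [folklore] -/
theorem norm_affinityB_le (z : ℂ) : ‖B z‖ ≤ 2 * ‖z‖ := by
  rw [← sq_le_sq₀ (norm_nonneg _) (by positivity), sq_norm_affinityB hB, mul_pow, Complex.sq_norm,
    Complex.normSq_apply]
  nlinarith [sq_nonneg z.re, sq_nonneg z.im]

/-- `dist (B p) (B q) ≤ 2 dist p q`. [folklore] -/
theorem dist_affinityB_le (p q : ℂ) : dist (B p) (B q) ≤ 2 * dist p q := by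
  rw [dist_eq_norm, dist_eq_norm, affinityB_sub hB]
  exact norm_affinityB_le hB _

/-- `dist p q ≤ dist (B p) (B q)`. [folklore] -/
theorem dist_le_dist_affinityB (p q : ℂ) : dist p q ≤ dist (B p) (B q) := by
  rw [dist_eq_norm, dist_eq_norm, affinityB_sub hB]
  exact norm_le_norm_affinityB hB _

/-- **Distances to the complement shrink at most under `B⁻¹`**: for a bounded `Ω`,
`infDist p (B⁻¹Ω)ᶜ ≤ infDist (B p) Ωᶜ`. [folklore] -/
theorem infDist_compl_preimage_le {Ω : Set ℂ} (hΩ : Bornology.IsBounded Ω) (p : ℂ) :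
    infDist p (B.symm '' Ω)ᶜ ≤ infDist (B p) Ωᶜ := by
  have hne : Ωᶜ.Nonempty := by
    rw [nonempty_compl]
    exact fun h => NormedSpace.unbounded_univ ℝ ℂ (h ▸ hΩ)
  by_contra h
  push Not at h
  obtain ⟨t, ht, hlt⟩ := (infDist_lt_iff hne).1 h
  have ht' : B.symm t ∈ (B.symm '' Ω)ᶜ := by
    rintro ⟨e, he, hte⟩
    exact ht (B.symm.injective hte ▸ he)
  have h1 : infDist p (B.symm '' Ω)ᶜ ≤ dist p (B.symm t) := infDist_le_dist_of_mem ht'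
  have h2 : dist p (B.symm t) ≤ dist (B p) t := by
    have := dist_le_dist_affinityB hB p (B.symm t)
    rwa [B.apply_symm_apply] at this
  linarith

end Affinity

/-! ### The registered stub -/

/-- **STUB BA_T of line `birth` (reshape 5) — `stub_boundaryAvoidanceTransport` (registered signature,
literal): (BA_hex) ⇒ its jittered form.**  Given the plain-honeycomb boundary avoidance, fix `B`,
`E`, a jittered endpoint approximation `(a', b')`, `ρ, ε > 0`.  By `stub_affineTransport`, `(a', b')`
is a hexagonal endpoint approximation of `B⁻¹E = E.map B.symm`; (BA_hex) there with `(ρ/4, ε)`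
gives a collar `η`.  Claim: collar `η/2` works for the jittered law once `δ ≤ 3 min(η, ρ)/4`.  The
jittered law is the push-forward of the plain law of `B⁻¹E` along the support-preserving bijection
of walks induced by the identity of vertices (`embDomainGraph_affine`,
`exists_support_preserving_map_embLaw`), and the jittered collar-visit event pulls back INTO the
plain one: for a visited vertex `w` with brick-wall site `x = site w`, `p = δ c_w`, `q = δ B c_w = B p`,
`m = δ x`: `dist m q ≤ 2δ/3`, so `infDist(p, (B⁻¹E)ᶜ) ≤ infDist(q, Eᶜ) ≤ infDist(m, Eᶜ) + 2δ/3 <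
η/2 + 2δ/3 ≤ η`, and `ρ ≤ dist(m, E.pt i) ≤ 2δ/3 + dist(q, E.pt i) ≤ 2δ/3 + 2 dist(p, B⁻¹ E.pt i)`
gives `dist(p, (B⁻¹E).pt i) ≥ ρ/4`. [folklore] -/
theorem stub_boundaryAvoidanceTransport : (∀ (D : DobrushinDomain) (a b : ℝ → HexVertex), SAW.IsEmbEndpointApprox hexGraph hexCenter D a b → ∀ ρ : ℝ, 0 < ρ → ∀ ε : ℝ, 0 < ε → ∃ η : ℝ, 0 < η ∧ ∀ᶠ δ in nhdsWithin 0 (Set.Ioi 0), SAW.hexSAWLaw D.carrier δ (a δ) (b δ) {γ | ∃ w ∈ γ.walk.support, Metric.infDist ((δ : ℂ) * hexCenter w) D.carrierᶜ < η ∧ ∀ i, ρ ≤ dist ((δ : ℂ) * hexCenter w) (D.pt i)} ≤ ENNReal.ofReal ε) → ∀ B : ℂ ≃ₜ ℂ, (∀ z : ℂ, B z = ((2 * z.re : ℝ) : ℂ) + ((2 / Real.sqrt 3 * z.im : ℝ) : ℂ) * Complex.I) → ∀ (E : DobrushinDomain) (a' b' : ℝ → HexVertex), SAW.IsEmbEndpointApprox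 hexGraph (fun v => B (hexCenter v)) E a' b' → ∀ ρ : ℝ, 0 < ρ → ∀ ε : ℝ, 0 < ε → ∃ η : ℝ, 0 < η ∧ ∀ᶠ δ in nhdsWithin 0 (Set.Ioi 0), SAW.embLaw hexGraph (fun v => B (hexCenter v)) E.carrier δ SAW.hexCriticalFugacity (a' δ) (b' δ) {γ | ∃ x ∈ γ.walk.support.map fun w : HexVertex => (![2 * w.1 0 + w.1 1 + ((w.2 : ℕ) : ℤ) + 1, w.1 1] : Site 2), Metric.infDist (meshPoint δ x) E.carrierᶜ < η ∧ ∀ i, ρ ≤ dist (meshPoint δ x) (E.pt i)} ≤ ENNReal.ofReal ε := by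
  intro hH B hB E a' b' hab' ρ hρ ε hε
  have hBsmul := affT_real_mul hB
  have hBline := affT_lineMap hB
  obtain ⟨habH, -⟩ := stub_affineTransport B hB E a' b' hab'
  obtain ⟨η, hη, hev⟩ := hH (E.map B.symm) a' b' habH (ρ / 4) (by positivity) ε hε
  refine ⟨η / 2, by positivity, ?_⟩
  have hδsmall : ∀ᶠ δ in 𝓝[>] (0 : ℝ), 0 < δ ∧ 4 * δ ≤ 3 * η ∧ 4 * δ ≤ 3 * ρ := by
    filter_upwards [Ioo_mem_nhdsGT (show (0 : ℝ) < min (η / 2) (ρ / 2) by positivity)] with δ hδ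
    refine ⟨hδ.1, ?_, ?_⟩
    · linarith [hδ.2, min_le_left (η / 2) (ρ / 2)]
    · linarith [hδ.2, min_le_right (η / 2) (ρ / 2)]
  filter_upwards [hev, hδsmall] with δ hδH hδ
  have habs : |δ| = δ := abs_of_pos hδ.1
  -- the two laws along the identity of vertices
  have hG : SAW.embDomainGraph hexGraph hexCenter (B.symm '' E.carrier) δ =
      SAW.embDomainGraph hexGraph (fun v => B (hexCenter v)) E.carrier δ :=
    embDomainGraph_affine hexGraph hexCenter B hBsmul hBline E.carrier δ
  obtain ⟨T, hTsupp, hTlaw⟩ :=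
    exists_support_preserving_map_embLaw hG SAW.hexCriticalFugacity (a' δ) (b' δ)
  have hTm : Measurable T := SAW.EmbDomainSAW.measurable_of_top _
  rw [MarkedDomain.carrier_map] at hδH
  rw [← hTlaw, Measure.map_apply hTm MeasurableSpace.measurableSet_top]
  refine le_trans (measure_mono ?_) hδH
  -- the jittered collar-visit event pulls back into the plain one
  rintro γ ⟨x, hx, hcollar, hfar⟩
  rw [hTsupp γ, List.mem_map] at hx
  obtain ⟨w, hw, rfl⟩ := hx
  refine ⟨w, hw, ?_, fun i => ?_⟩
  · -- collar
    have hjit : dist (meshPoint δ (![2 * w.1 0 + w.1 1 + ((w.2 : ℕ) : ℤ) + 1, w.1 1] : Site 2))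
        ((δ : ℂ) * B (hexCenter w)) ≤ 2 * δ / 3 := by
      simpa [habs] using dist_meshPoint_site_le hB δ w
    have h1 : infDist ((δ : ℂ) * hexCenter w) (B.symm '' E.carrier)ᶜ ≤
        infDist ((δ : ℂ) * B (hexCenter w)) E.carrierᶜ := by
      have := infDist_compl_preimage_le hB E.isBounded ((δ : ℂ) * hexCenter w)
      rwa [hBsmul] at this
    have h2 : infDist ((δ : ℂ) * B (hexCenter w)) E.carrierᶜ ≤
        infDist (meshPoint δ (![2 * w.1 0 + w.1 1 + ((w.2 : ℕ) : ℤ) + 1, w.1 1] : Site 2))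
          E.carrierᶜ + 2 * δ / 3 := by
      have := Metric.infDist_le_infDist_add_dist (s := E.carrierᶜ)
        (x := (δ : ℂ) * B (hexCenter w))
        (y := meshPoint δ (![2 * w.1 0 + w.1 1 + ((w.2 : ℕ) : ℤ) + 1, w.1 1] : Site 2))
      rw [dist_comm] at this
      linarith
    linarith [hδ.2.1]
  · -- far from the marked points
    have hjit : dist (meshPoint δ (![2 * w.1 0 + w.1 1 + ((w.2 : ℕ) : ℤ) + 1, w.1 1] : Site 2))
        ((δ : ℂ) * B (hexCenter w)) ≤ 2 * δ / 3 := by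
      simpa [habs] using dist_meshPoint_site_le hB δ w
    have hfar' := hfar i
    have h1 : dist (meshPoint δ (![2 * w.1 0 + w.1 1 + ((w.2 : ℕ) : ℤ) + 1, w.1 1] : Site 2))
        (E.pt i) ≤ 2 * δ / 3 + dist ((δ : ℂ) * B (hexCenter w)) (E.pt i) := by
      have := dist_triangle
        (meshPoint δ (![2 * w.1 0 + w.1 1 + ((w.2 : ℕ) : ℤ) + 1, w.1 1] : Site 2))
        ((δ : ℂ) * B (hexCenter w)) (E.pt i)
      linarith
    have h2 : dist ((δ : ℂ) * B (hexCenter w)) (E.pt i) ≤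
        2 * dist ((δ : ℂ) * hexCenter w) ((E.map B.symm).pt i) := by
      rw [MarkedDomain.pt_map, ← hBsmul]
      have := dist_affinityB_le hB ((δ : ℂ) * hexCenter w) (B.symm (E.pt i))
      rwa [B.apply_symm_apply] at this
    linarith [hδ.2.2]

end Summit.CriticalPhenomena.SAWScalingLimit.Cruxes.ModulusUniversality.Birth

end
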